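import Literature.MathematicalPhysics.QuantumFieldTheory.Sweep1ChatterjeeFreeEnergyProofs
import Literature.MathematicalPhysics.QuantumLattice.RepLieAlgebra
import Summits.QuantumFields.YangMills.Theses.EquipartitionCriticality
import HarnessLib

/-!
# `FreeEnergyLogCoefficient` (crux `stmt-QuantumFields-8759`) — skeleton of line `Sketch`

Route `EquipartitionCriticality`, crux
`Summit.QuantumFields.YangMills.Theses.EquipartitionCriticality.FreeEnergyLogCoefficient`:
`∀ G` compact simple Lie, `∀ r : LatticeRep G`, `∃ K`, `f_r(β) + (3 D/2) log β → K` with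
`D = finrank(span{X | ∀ t, exp(tX) ∈ range r.ρ})`.

LINE (port of the tree's mechanised `U(N)` proof of Chatterjee's Theorem 2.1,
`chatterjee_freeEnergy_holds`, to `r(G) ≤ U(N)` via the exponential chart with a soft Haar constant):
seven stubs `stub_*` (sorried here, proved in sibling helper files) and the composition
`FreeEnergyLogCoefficient_of`.

The shared definitions (`OneBoxBounds`, `maxwellV`, `expChart`, …) are INLINED below until the Defs
file `EquipartitionCriticalityFreeEnergyLogCoefficientDefs.lean` lands; they are byte-identical.
-/

noncomputable section

open scoped Matrix.Norms.Frobenius ENNReal NNReal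
open MeasureTheory Measure Filter Topology Set
open Literature.Probability.LatticeModels Literature.MathematicalPhysics.QuantumLattice
open Literature.MathematicalPhysics.QuantumFieldTheory

namespace Summit.QuantumFields.YangMills.Theorems.FreeEnergyLogCoefficient

/-! ### The abstract one-box interface of the joint limit -/

/-- **Abstract one-box bounds** (the interface between the group-specific part of Chatterjee's proof,
§§6–16, and the group-free joint limit of §17): `logZ n β = log Z(B_n, β)` for the free-boundary cube
`B_n = {0,…,n-1}^d` together with
* `thm71` (Thm. 7.1: `log Z ≥ −C71 n^d log β` for `β ≥ 2`), `logZ_nonpos` (`Z ≤ 1`), `logZ_anti`;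
* `mul_le` (Lemma 17.3: `log Z(B_{(m+1)k}) ≤ k^d log Z(B_m)`) and `le_mul` (Lemma 17.5 with the
  plaquette-dropping cost `P₅`, `= N + M` for `|Re tr ρ| ≤ M`);
* `upper` (Lemma 17.2, logarithmic form, for `n ≥ 1`, valid when the Theorem-10.1 radius `ρ₀ ≤ r₁/2`)
  and `lower` (Lemma 17.6, logarithmic form, for `n ≥ 1`, chart radii `0 < r ≤ r₁` and any positive lower
  bound `L` of the Gaussian cube probability `τ_n(|y_e| ≤ √β r/ν ∀ e)`),
with `D` Gaussian directions per free link, soft Haar constant `cH`, cubic remainder constant `A` and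
chart distortion `κ` (`1 ≤ κ(r)`, `log κ(r) ≤ Kκ r` on `[0, r₁]`). The `U(N)` chain realises it with
`D = N²`, `cH = haarChartConst N`, `A = 67N`, `ν = N`, `r₁ = 1/4`, `κ(r) = (1+2r)(1+r/2)`.
[cite: arXiv160201222, §17 (Lemmas 17.2, 17.3, 17.5, 17.6), Thm. 7.1] -/
structure OneBoxBounds (d : ℕ) where
  /-- `log Z(B_n, β)`. -/
  logZ : ℕ → ℝ → ℝ
  /-- Number of Gaussian directions per free link (`dim 𝔤`). -/
  D : ℕ
  /-- Radius divisor in the Gaussian cube event (`N` for `U(N)`). -/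
  ν : ℝ
  /-- Soft Haar constant of the chart. -/
  cH : ℝ
  /-- Constant of Theorem 7.1. -/
  C71 : ℝ
  /-- Cubic remainder constant of the chart (Theorem 16.3). -/
  A : ℝ
  /-- Plaquette-dropping cost of Lemma 17.5. -/
  P₅ : ℝ
  /-- Admissible chart radius. -/
  r₁ : ℝ
  /-- Chart distortion at scale `r`. -/
  κ : ℝ → ℝ
  /-- Slope of `log κ` at `0`. -/
  Kκ : ℝ
  one_le_ν : 1 ≤ ν
  cH_pos : 0 < cH
  C71_pos : 0 < C71
  A_nonneg : 0 ≤ A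
  P₅_nonneg : 0 ≤ P₅
  r₁_pos : 0 < r₁
  r₁_le : r₁ ≤ 1 / 2
  Kκ_nonneg : 0 ≤ Kκ
  one_le_κ : ∀ r : ℝ, 0 ≤ r → r ≤ r₁ → 1 ≤ κ r
  log_κ_le : ∀ r : ℝ, 0 ≤ r → r ≤ r₁ → Real.log (κ r) ≤ Kκ * r
  logZ_nonpos : ∀ (n : ℕ) (β : ℝ), 0 ≤ β → logZ n β ≤ 0
  logZ_anti : ∀ (β : ℝ), 0 ≤ β → ∀ (n n' : ℕ), n ≤ n' → logZ n' β ≤ logZ n β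
  thm71 : ∀ (n : ℕ) (β : ℝ), 2 ≤ β → -(C71 * (n : ℝ) ^ d * Real.log β) ≤ logZ n β
  mul_le : ∀ (β : ℝ), 0 ≤ β → ∀ (m k : ℕ), logZ ((m + 1) * k) β ≤ (k : ℝ) ^ d * logZ m β
  le_mul : ∀ (β : ℝ), 0 ≤ β → ∀ (n k : ℕ),
    (k : ℝ) ^ d * (logZ n β -
        β * P₅ * (2 * (Fintype.card {q : Fin d × Fin d // q.1 < q.2} : ℝ) * (n : ℝ) ^ (d - 1))) -
      β * P₅ * ((Fintype.card {q : Fin d × Fin d // q.1 < q.2} : ℝ) *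
        ((k : ℝ) ^ d * (((n + 1 : ℕ) : ℝ) ^ d - (n : ℝ) ^ d))) ≤
      logZ ((n + 1) * k) β
  upper : ∀ (n : ℕ) (β : ℝ), 1 ≤ n → 2 ≤ β → WilsonWeakCoupling.rho0 C71 d n β ≤ r₁ / 2 →
    logZ n β ≤ Real.log 2 + (ChatterjeeAssembly.D₁ d n : ℝ) * Real.log cH +
      A * β * (2 * WilsonWeakCoupling.rho0 C71 d n β) ^ 3 * (ChatterjeeAssembly.Pn d n : ℝ) -
      ((ChatterjeeAssembly.D₁ d n : ℝ) * (D : ℝ) / 2) * Real.log β +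
      (D : ℝ) * ChatterjeeAssembly.logZM d n
  lower : ∀ (n : ℕ) (β : ℝ), 1 ≤ n → 2 ≤ β → ∀ (r : ℝ), 0 < r → r ≤ r₁ → ∀ (L : ℝ≥0∞), L ≠ 0 →
    L ≤ LatticeMaxwell.τ (LatticeMaxwell.pinI (d := d)) (0 : Site d) n
      {y | ∀ e, |y e| ≤ Real.sqrt β * r / ν} →
    (ChatterjeeAssembly.D₁ d n : ℝ) * (Real.log cH - (D : ℝ) * Real.log (κ r)) -
        A * β * r ^ 3 * (ChatterjeeAssembly.Pn d n : ℝ) -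
        ((ChatterjeeAssembly.D₁ d n : ℝ) * (D : ℝ) / 2) * Real.log β +
        (D : ℝ) * (ChatterjeeAssembly.logZM d n + Real.log L.toReal) ≤
      logZ n β

namespace OneBoxBounds

variable {d : ℕ} (B : OneBoxBounds d)

/-- The free energy per site `F(B_n, β) = log Z(B_n, β)/n^d`. [cite: arXiv160201222, §2] -/
def F (n : ℕ) (β : ℝ) : ℝ := B.logZ n β / (n : ℝ) ^ d

/-- The normalised free energy `T(B_n, β) = F(B_n, β) + (|E_n^1|/(2n^d)) D log β`. [cite: arXiv160201222, Thm. 2.1] -/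
def T (n : ℕ) (β : ℝ) : ℝ := B.F n β + ChatterjeeJointLimit.coef d n / 2 * (B.D : ℝ) * Real.log β

/-- The main term `(|E_n^1|/n^d) log c_H + D log Z_M(B_n)/n^d`. [cite: arXiv160201222, §17] -/
def Gm (n : ℕ) : ℝ :=
  ChatterjeeJointLimit.coef d n * Real.log B.cH + (B.D : ℝ) * (ChatterjeeAssembly.logZM d n / (n : ℝ) ^ d)

/-- The constant `K = C₇₁ + dD/2` with `|T(B_n, β)| ≤ K log β`. [folklore] -/
def Kc : ℝ := B.C71 + d * (B.D : ℝ) / 2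

/-- The constant `K₂ = 2dK + (d + 1 + 2d²)D/2` of the junk terms of Lemma 17.4. [folklore] -/
def K₂ : ℝ := 2 * d * B.Kc + ((d : ℝ) + 1 + 2 * (d : ℝ) ^ 2) * (B.D : ℝ) / 2

/-- The constant `K₃ = d2^{d-1}K + (d²2^{d-1} + d)D/2` of the rounding-up comparison. [folklore] -/
def K₃ : ℝ := d * 2 ^ (d - 1) * B.Kc + ((d : ℝ) ^ 2 * 2 ^ (d - 1) + d) * (B.D : ℝ) / 2

/-- The common error `Kκ d D β^{-2/5} + A d² β^{-1/5}` of the lower bound (radius `r = β^{-2/5}`). [cite: arXiv160201222, Lemma 17.6] -/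
def e0 (β : ℝ) : ℝ :=
  B.Kκ * d * (B.D : ℝ) * β ^ (-(2 / 5 : ℝ)) + B.A * (d : ℝ) ^ 2 * β ^ (-(1 / 5 : ℝ))

/-- The Theorem-14.3 error `D(2 log 2/β^b + 8d² B̄(β)/β^b)` of the lower bound. [cite: arXiv160201222, Lemma 17.6] -/
def errLB (β : ℝ) : ℝ :=
  (B.D : ℝ) * (2 * Real.log 2 / β ^ ChatterjeeJointLimit.bL d +
    8 * (d : ℝ) ^ 2 * ChatterjeeJointLimit.Bbar d β / β ^ ChatterjeeJointLimit.bL d)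

/-- The error of the descent `n → n'' ≍ β^{2+b}` (Lemma 17.5) for `n > β³`. [cite: arXiv160201222, Lemma 17.7 (proof)] -/
def JD (β : ℝ) : ℝ :=
  ((d : ℝ) / β ^ 2 + 3 * d * 2 ^ (d - 1) * (β ^ ChatterjeeJointLimit.bL d / β)) * (B.Kc + d * (B.D : ℝ) / 2) *
      Real.log β +
    ((d : ℝ) + 1) * (B.D : ℝ) * (Real.log β / β ^ 2) + 2 ^ d * ((d : ℝ) + 2) * B.P₅ * (d : ℝ) ^ 2 / β

end OneBoxBounds

/-! ### Lie-algebra configurations with values in a normed group -/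

section Maxwell

variable {d : ℕ} {V : Type*} [NormedAddCommGroup V]

/-- Extension by `0` (on the comb tree and off the box) of a `V`-valued configuration on the free
edges `E_n^1` of the cube: the Lie-algebra configuration `H ∈ H_0(B_n)` of §16
(`WilsonWeakCoupling.zeroExt` for general `V`). [cite: arXiv160201222, §16] -/
def zeroExtV {n : ℕ} (a : WilsonWeakCoupling.FreeIdx d n → V) :
    Literature.MathematicalPhysics.QuantumFieldTheory.ZdEdge d → V := fun e =>
  if h : e ∈ AxialGauge.boxEdges d n then
    (if hc : AxialGauge.IsComb e then 0 else a ⟨⟨e, h⟩, hc⟩) else 0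

/-- The plaquette circulation `H(p) = H(x,j) + H(x+e_j,k) − H(x+e_k,j) − H(x,k)` of a `V`-valued
configuration (`WilsonWeakCoupling.circ` for general `V`). [cite: arXiv160201222, §16] -/
def circV (H : Literature.MathematicalPhysics.QuantumFieldTheory.ZdEdge d → V) (p : Plaq d) : V :=
  H (p.1, p.2.1) + H (p.1 + Pi.single p.2.1 1, p.2.2) - H (p.1 + Pi.single p.2.2 1, p.2.1) - H (p.1, p.2.2)

variable (d) in
/-- **The lattice Maxwell action** `M_n(H) = Σ_{p ∈ B_n'} ‖H(p)‖²` of the configuration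
`H = zeroExtV a` (`WilsonWeakCoupling.maxwell` for general `V`; for `V = ℝ^D` it is the sum of `D`
copies of the scalar axial-gauge Maxwell form of `LatticeMaxwellGaussian`). [cite: arXiv160201222, §16] -/
def maxwellV (n : ℕ) (a : WilsonWeakCoupling.FreeIdx d n → V) : ℝ :=
  ∑ p ∈ plaquettesIn (halfOpenBox d n), ‖circV (zeroExtV a) p‖ ^ 2

end Maxwell

/-! ### The exponential chart of a compact matrix group -/

section ExpChart

variable {N : ℕ} {G : Type*} [Group G] (ρ : G →* Matrix (Fin N) (Fin N) ℂ)

/-- The Lie algebra `𝔤_ρ = matrixLieAlgebra (range ρ) ⊆ 𝔲(N)` read in the isometric coordinates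
`UnitaryCayley.skewOf : ℝ^{N²} → 𝔲(N)` of the skew-Hermitian matrices: a subspace of the Euclidean
space `ℝ^{N²}`, so that it carries the Hilbert–Schmidt inner product `Re tr(X Y†)`. [cite: arXiv160201222, §11] -/
def liePre : Submodule ℝ (UnitaryCayley.𝔼 N) :=
  (matrixLieAlgebra (Set.range ρ)).comap (UnitaryCayley.skewOf (N := N)).toLinearMap

/-- The real dimension `D = dim_ℝ 𝔤_ρ` of the Lie algebra in chart coordinates
(`= Module.finrank ℝ (matrixLieAlgebra (range ρ))` for unitary `ρ`, proved in the chart files). [folklore] -/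
def dimE : ℕ := Module.finrank ℝ ↥(liePre ρ)

/-- **Isometric parametrisation of the Lie algebra**: `lieIso ρ : ℝ^D → M_N(ℂ)`, an `ℝ`-linear
isometry (Euclidean norm to Hilbert–Schmidt norm) with image `𝔤_ρ` when `ρ` is unitary — an
orthonormal basis of `liePre ρ` followed by `skewOf`. [cite: arXiv160201222, §11] -/
def lieIso : EuclideanSpace ℝ (Fin (dimE ρ)) →ₗᵢ[ℝ] Matrix (Fin N) (Fin N) ℂ :=
  ((UnitaryCayley.skewOf (N := N)).comp (liePre ρ).subtypeₗᵢ).comp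
    (stdOrthonormalBasis ℝ ↥(liePre ρ)).repr.symm.toLinearIsometry

/-- **The exponential chart** `ψ(a) = ρ⁻¹(exp(lieIso ρ a))` of the compact group `G` presented by
the faithful representation `ρ` (von Neumann 1929; Chatterjee §11 uses `H ↦ e^{iH}` on `U(N)`): a
continuous map `ℝ^D → G` with `ρ (ψ a) = exp (lieIso ρ a)`, a homeomorphism near `0 ↦ 1`
(`Function.invFun`: junk off the image of `ρ`, which does not occur for `a` in chart coordinates).
[cite: arXiv160201222, §11] -/
def expChart (a : EuclideanSpace ℝ (Fin (dimE ρ))) : G :=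
  Function.invFun ρ (NormedSpace.exp (lieIso ρ a))

variable [TopologicalSpace G] [IsTopologicalGroup G] [CompactSpace G] [MeasurableSpace G]
  [BorelSpace G]

/-- **The chart measure** `ν_R(A) = σ(ψ(A ∩ b(0,R)))`: the pull-back of the Haar probability measure
`σ` of `G` along the exponential chart restricted to the closed ball `b(0, R)` (where it is injective
for small `R`), as a measure on `ℝ^D` (Chatterjee §11, the measure `ν`; `UnitaryCayley.chartMeasure`
for the globally injective Cayley chart). [cite: arXiv160201222, §11] -/
def chartMeasureE (R : ℝ) : Measure (EuclideanSpace ℝ (Fin (dimE ρ))) :=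
  ((haarProbability G).comap
      ((Metric.closedBall (0 : EuclideanSpace ℝ (Fin (dimE ρ))) R).restrict (expChart ρ))).map
    Subtype.val

/-- The small-ball ratio `g(δ) = σ(B(1,δ)) / vol(b(0,δ))` (Haar measure of the Hilbert–Schmidt ball
of `G` over Lebesgue measure of the Euclidean ball of `ℝ^D`; `UnitaryCayley.ballRatio`).
[cite: arXiv160201222, Thm. 6.1 (analogue)] -/
def ballRatioE (δ : ℝ) : ℝ≥0∞ :=
  haarProbability G {g : G | ‖ρ g - 1‖ ≤ δ} /
    volume (Metric.closedBall (0 : EuclideanSpace ℝ (Fin (dimE ρ))) δ)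

/-- **The soft Haar constant** `c_H = lim_{δ→0⁺} σ(B(1,δ))/vol(b(0,δ))` of `G` in the exponential
chart, as a `limUnder` (meaningful once the limit is shown to exist; `UnitaryCayley.haarChartConst`).
[cite: arXiv160201222, Thm. 11.1 (analogue)] -/
def haarConstE : ℝ≥0∞ := limUnder (𝓝[>] (0 : ℝ)) (ballRatioE ρ)

omit [TopologicalSpace G] [IsTopologicalGroup G] [CompactSpace G] [MeasurableSpace G] [BorelSpace G] in
/-- The distortion `κ(r) = (2 − e^{4r})⁻¹ ∨ …` of the exponential chart at scale `r` (the inverse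
Lipschitz constant of `exp` on the Hilbert–Schmidt ball of radius `4r`, Chatterjee Lemma 11.2, capped
so that `1 ≤ κ ≤ 2` everywhere). [cite: arXiv160201222, Lemma 11.2] -/
def κE (r : ℝ) : ℝ := (max (2 - Real.exp (4 * r)) (1 / 2))⁻¹

end ExpChart

end Summit.QuantumFields.YangMills.Theorems.FreeEnergyLogCoefficient

end


/-! ## The stubs of line `Sketch` (crux `stmt-QuantumFields-8759`)

Seven registered stubs; `FreeEnergyLogCoefficient_of` composes them into the crux. -/

namespace Summit.QuantumFields.YangMills.Theorems.FreeEnergyLogCoefficient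

open scoped Matrix Matrix.Norms.Frobenius ENNReal NNReal
open MeasureTheory Measure Filter Topology Set
open Literature.Probability.LatticeModels Literature.MathematicalPhysics.QuantumLattice
open Literature.MathematicalPhysics.QuantumFieldTheory

/-- **STUB 1 — the abstract joint limit (Chatterjee §17, Lemmas 17.1–17.7, group-free).** From the
one-box interface `B : OneBoxBounds d` and the existence of the lattice Maxwell free energy per site
(`log Z_M(B_n)/n^d → L`, Theorem 15.2, in tree), jointly as `n → ∞`, `β → ∞`:
`T(B_n, β) = log Z(B_n,β)/n^d + (|E_n^1|/(2n^d)) D log β → (d−1) log c_H + D L`.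
Port of `ChatterjeeFreeEnergyBounds` (from `T_le_G_add` on) and `ChatterjeeFreeEnergyJointLimit` with
`N² ↦ B.D`, `haarChartConst N ↦ B.cH`, `C71 d N ↦ B.C71`, `67·N ↦ B.A`, `2N ↦ B.P₅` (Lemma 17.5 cost),
`/N ↦ /B.ν`, `1/2, 1/8 ↦ B.r₁, B.r₁/2`, `κ ↦ B.κ` (`log κ r ≤ Kκ r`). [cite: arXiv160201222, §17] -/
theorem stub_abstractJointLimit {d : ℕ} (hd : 2 ≤ d) (B : OneBoxBounds d) {L : ℝ}
    (hL : Tendsto (fun n : ℕ => ChatterjeeAssembly.logZM d n / (n : ℝ) ^ d) atTop (𝓝 L)) :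
    Tendsto (fun p : ℕ × ℝ => B.T p.1 p.2) (atTop ×ˢ atTop)
      (𝓝 (((d : ℝ) - 1) * Real.log B.cH + (B.D : ℝ) * L)) := by
  sorry

/-- **STUB 3 — Lemma 16.2 for the exponential chart.** For skew-Hermitian `Y₁,…,Y₄` of Frobenius
norm `≤ η ≤ 1`, `|Re tr(1 − e^{Y₁}e^{Y₂}e^{Y₃}e^{Y₄}) − ½‖Y₁+Y₂+Y₃+Y₄‖²| ≤ A₀ N η³` with a universal
constant `A₀` (printed proof: expand the four factors to second order, `Re tr Yᵢ = 0`,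
`½ tr ΣYᵢ² + tr Σ_{i<j} YᵢYⱼ = ½ tr(ΣYᵢ)²`, `|Re tr M| ≤ N‖M‖_F`; template
`UnitaryCayley.abs_re_trace_one_sub_cay_prod_sub_le`). [cite: arXiv160201222, Lemma 16.2] -/
theorem stub_fourProduct : ∃ A₀ : ℝ, 0 ≤ A₀ ∧ ∀ {N : ℕ} (Y₁ Y₂ Y₃ Y₄ : Matrix (Fin N) (Fin N) ℂ),
    Y₁ᴴ = -Y₁ → Y₂ᴴ = -Y₂ → Y₃ᴴ = -Y₃ → Y₄ᴴ = -Y₄ → ∀ η : ℝ, η ≤ 1 →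
    ‖Y₁‖ ≤ η → ‖Y₂‖ ≤ η → ‖Y₃‖ ≤ η → ‖Y₄‖ ≤ η →
    |((1 - NormedSpace.exp Y₁ * NormedSpace.exp Y₂ * NormedSpace.exp Y₃ * NormedSpace.exp Y₄).trace).re -
        ‖Y₁ + Y₂ + Y₃ + Y₄‖ ^ 2 / 2| ≤ A₀ * N * η ^ 3 := by
  sorry

section Group

variable {d N : ℕ} {G : Type*} [Group G] [TopologicalSpace G] [IsTopologicalGroup G]
  [CompactSpace G] [MeasurableSpace G] [BorelSpace G]

/-- **STUB 2 — the exponential chart package of a compact matrix group (soft Haar constant).** For a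
faithful continuous unitary `ρ`: the chart `ψ = expChart ρ` is continuous with `ρ ∘ ψ = exp ∘ lieIso ρ`
into `𝔤_ρ ⊆ 𝔲(N)` (`dimE ρ = dim 𝔤_ρ`); the distortion `κE` is in `[1, 2]` with `log κE(r) ≤ 16 r`
on `[0, r₁]`; small balls have Haar measure `≥ C₁ δ^D` (Cor. 6.3, soft); `B(1, r/κE(r)) ⊆ ψ(b(0,r))`
(Cor. 11.3 via von Neumann's `exists_exp_chart_range` and Lemma 11.2); and the two-sided comparison of
product integrals near the identity with a soft constant `c_H` (Thm. 11.1, second assertion, by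
Lebesgue differentiation as in `UnitaryCayley.exists_tendsto_ballRatio`). [cite: arXiv160201222, Thm. 11.1, Cor. 11.3, Cor. 6.3] -/
theorem stub_expChartPackage [SecondCountableTopology G] (ρ : G →* Matrix (Fin N) (Fin N) ℂ)
    (hρ : Continuous ρ) (hinj : Function.Injective ρ)
    (hU : ∀ g, ρ g ∈ Matrix.unitaryGroup (Fin N) ℂ) :
    Continuous (expChart ρ) ∧ (∀ a, ρ (expChart ρ a) = NormedSpace.exp (lieIso ρ a)) ∧
    (∀ a, (lieIso ρ a)ᴴ = -(lieIso ρ a)) ∧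
    dimE ρ = Module.finrank ℝ ↥(matrixLieAlgebra (Set.range ρ)) ∧
    ∃ (cH r₁ C₁ : ℝ), 0 < cH ∧ 0 < r₁ ∧ r₁ ≤ 1 / 2 ∧ 0 < C₁ ∧
      (∀ r : ℝ, 0 ≤ r → r ≤ r₁ → 1 ≤ κE r ∧ κE r ≤ 2 ∧ Real.log (κE r) ≤ 16 * r) ∧
      (∀ δ : ℝ, 0 < δ → δ ≤ 1 →
        ENNReal.ofReal (C₁ * δ ^ dimE ρ) ≤ haarProbability G {g : G | ‖ρ g - 1‖ ≤ δ}) ∧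
      (∀ r : ℝ, 0 ≤ r → r ≤ r₁ → {g : G | ‖ρ g - 1‖ ≤ r / κE r} ⊆ expChart ρ '' Metric.closedBall 0 r) ∧
      (∀ (ι : Type) [Fintype ι] (r : ℝ), 0 < r → r ≤ r₁ → ∀ F : (ι → G) → ℝ≥0∞, Measurable F →
        ∫⁻ U in Set.pi Set.univ (fun _ => expChart ρ '' Metric.closedBall 0 r), F U
            ∂(Measure.pi fun _ : ι => haarProbability G) ≤
          ENNReal.ofReal cH ^ Fintype.card ι *
            ∫⁻ a in Set.pi Set.univ
              (fun _ => Metric.closedBall (0 : EuclideanSpace ℝ (Fin (dimE ρ))) r),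
              F (fun i => expChart ρ (a i))) ∧
      (∀ (ι : Type) [Fintype ι] (r : ℝ), 0 < r → r ≤ r₁ → ∀ F : (ι → G) → ℝ≥0∞, Measurable F →
        ((ENNReal.ofReal (κE r ^ dimE ρ))⁻¹ * ENNReal.ofReal cH) ^ Fintype.card ι *
            ∫⁻ a in Set.pi Set.univ
              (fun _ => Metric.closedBall (0 : EuclideanSpace ℝ (Fin (dimE ρ))) r),
              F (fun i => expChart ρ (a i)) ≤
          ∫⁻ U in Set.pi Set.univ (fun _ => expChart ρ '' Metric.closedBall 0 r), F U
            ∂(Measure.pi fun _ : ι => haarProbability G)) := by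
  sorry

/-- **STUB 4 — weak-coupling a-priori bounds for a unitary representation (Chatterjee §§7, 8, 10).**
`Z(B_n, β) ≤ 1` (`β ≥ 0`); Theorem 7.1 (`Z ≥ exp(−C n^d log β)`, `β ≥ 2`, from the small-ball lower
bound `σ(B(1,δ)) ≥ C₁ δ^D`); Theorem 10.1 (Cor. 8.2 + axial gauge Cor. 9.4 + the discrete Poincaré
inequality Lemma 10.2): `Z ≤ 2 ∫_{B(1,ρ₀)^{E_n^1}} e^{−βS(1, v)} dσ^{E_n^1}`. Port of
`WilsonWeakCoupling.{S_eq, Z_le_one, norm_one_sub_sq_le_l1_mul_S, exists_Z_ge,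
Z_le_two_mul_setLIntegral, Z_le_two_mul_lintegral_free}` from `𝔾 N` to `ρ(G) ⊆ U(N)`. [cite: arXiv160201222, Thm. 7.1, Cor. 8.2, Thm. 10.1] -/
theorem stub_weakCoupling [SecondCountableTopology G] (ρ : G →* Matrix (Fin N) (Fin N) ℂ)
    (hρ : Continuous ρ) (hU : ∀ g, ρ g ∈ Matrix.unitaryGroup (Fin N) ℂ) {D : ℕ} {C₁ : ℝ}
    (hC₁ : 0 < C₁)
    (hball : ∀ δ : ℝ, 0 < δ → δ ≤ 1 →
      ENNReal.ofReal (C₁ * δ ^ D) ≤ haarProbability G {g : G | ‖ρ g - 1‖ ≤ δ}) :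
    (∀ (n : ℕ) (β : ℝ), 0 ≤ β → zdPartitionFunction ρ β (halfOpenBox d n) ≤ 1) ∧
    ∃ C : ℝ, 0 < C ∧
      (∀ (n : ℕ) (β : ℝ), 2 ≤ β →
        ENNReal.ofReal (Real.exp (-(C * n ^ d * Real.log β))) ≤
          zdPartitionFunction ρ β (halfOpenBox d n)) ∧
      (∀ (n : ℕ) (β : ℝ), 2 ≤ β → zdPartitionFunction ρ β (halfOpenBox d n) ≤
        2 * ∫⁻ v in Set.pi Set.univ (fun _ => {g : G | ‖ρ g - 1‖ ≤ WilsonWeakCoupling.rho0 C d n β}),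
          ENNReal.ofReal (Real.exp (-β * zdWilsonAction ρ (halfOpenBox d n)
            (AxialGauge.ext (AxialGauge.ext₁ v))))
          ∂(Measure.pi fun _ : WilsonWeakCoupling.FreeIdx d n => haarProbability G)) := by
  sorry

/-- **STUB 5 — the chart comparison of the Wilson action with the Maxwell action and the Gaussian
sandwich (Chatterjee Thm. 16.3, Lemmas 17.2/17.6 up to the Gaussian integral).** For a chart
`ψ : ℝ^D → G` with `ρ ∘ ψ = exp ∘ ι₀`, `ι₀` an isometry into `𝔲(N)`, the four-product bound with
constant `A₀`, the Theorem 7.1/10.1 constant `C`, and the two-sided product comparison of Haar and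
Lebesgue integrals near `1` (constants `cH`, `κ`, radius `r₁`, `B(1, r/κ r) ⊆ ψ(b(0,r))`, `κ ≤ 2`):
`Z ≤ 2 cH^{|E_n^1|} e^{A₀Nβ(2ρ₀)³|B_n'|} ∫ e^{−βM_n(a)/2} da` when `ρ₀ ≤ r₁/2`, and
`Z ≥ (cH κ(r)^{−D})^{|E_n^1|} e^{−A₀Nβr³|B_n'|} ∫_{b(0,r)^{E_n^1}} e^{−βM_n(a)/2} da` for `0 < r ≤ r₁`.
Port of `WilsonWeakCoupling.{abs_plaquetteCost_chart_sub_le, abs_S_chart_sub_maxwell_le,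
weight_chartPi_le, le_weight_chartPi, Z_le_gaussian, gaussian_le_Z}` with `maxwellV` on `ℝ^D`. [cite: arXiv160201222, Thm. 16.3, Lemmas 17.2, 17.6] -/
theorem stub_chartAction [SecondCountableTopology G] (hd : 1 ≤ d) (ρ : G →* Matrix (Fin N) (Fin N) ℂ)
    (hρ : Continuous ρ) (hU : ∀ g, ρ g ∈ Matrix.unitaryGroup (Fin N) ℂ) {D : ℕ}
    (ι₀ : EuclideanSpace ℝ (Fin D) →ₗᵢ[ℝ] Matrix (Fin N) (Fin N) ℂ) (hι₀ : ∀ a, (ι₀ a)ᴴ = -(ι₀ a))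
    (ψ : EuclideanSpace ℝ (Fin D) → G) (hψm : Measurable ψ)
    (hψ : ∀ a, ρ (ψ a) = NormedSpace.exp (ι₀ a))
    {A₀ : ℝ} (hA₀ : 0 ≤ A₀)
    (h4 : ∀ (Y₁ Y₂ Y₃ Y₄ : Matrix (Fin N) (Fin N) ℂ),
      Y₁ᴴ = -Y₁ → Y₂ᴴ = -Y₂ → Y₃ᴴ = -Y₃ → Y₄ᴴ = -Y₄ → ∀ η : ℝ, η ≤ 1 →
      ‖Y₁‖ ≤ η → ‖Y₂‖ ≤ η → ‖Y₃‖ ≤ η → ‖Y₄‖ ≤ η →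
      |((1 - NormedSpace.exp Y₁ * NormedSpace.exp Y₂ * NormedSpace.exp Y₃ *
          NormedSpace.exp Y₄).trace).re - ‖Y₁ + Y₂ + Y₃ + Y₄‖ ^ 2 / 2| ≤ A₀ * N * η ^ 3)
    {C : ℝ} (hC : 0 < C)
    (h101 : ∀ (n : ℕ) (β : ℝ), 2 ≤ β → zdPartitionFunction ρ β (halfOpenBox d n) ≤
      2 * ∫⁻ v in Set.pi Set.univ (fun _ => {g : G | ‖ρ g - 1‖ ≤ WilsonWeakCoupling.rho0 C d n β}),
        ENNReal.ofReal (Real.exp (-β * zdWilsonAction ρ (halfOpenBox d n)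
          (AxialGauge.ext (AxialGauge.ext₁ v))))
        ∂(Measure.pi fun _ : WilsonWeakCoupling.FreeIdx d n => haarProbability G))
    {cH r₁ : ℝ} (hcH : 0 < cH) (hr₁ : r₁ ≤ 1) {κ : ℝ → ℝ}
    (hκ : ∀ r : ℝ, 0 ≤ r → r ≤ r₁ → 1 ≤ κ r ∧ κ r ≤ 2)
    (hincl : ∀ r : ℝ, 0 ≤ r → r ≤ r₁ → {g : G | ‖ρ g - 1‖ ≤ r / κ r} ⊆ ψ '' Metric.closedBall 0 r)
    (hup : ∀ (n : ℕ) (r : ℝ), 0 < r → r ≤ r₁ →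
      ∀ F : (WilsonWeakCoupling.FreeIdx d n → G) → ℝ≥0∞, Measurable F →
      ∫⁻ U in Set.pi Set.univ (fun _ => ψ '' Metric.closedBall 0 r), F U
          ∂(Measure.pi fun _ : WilsonWeakCoupling.FreeIdx d n => haarProbability G) ≤
        ENNReal.ofReal cH ^ Fintype.card (WilsonWeakCoupling.FreeIdx d n) *
          ∫⁻ a in Set.pi Set.univ (fun _ => Metric.closedBall (0 : EuclideanSpace ℝ (Fin D)) r),
            F (fun i => ψ (a i)))
    (hlow : ∀ (n : ℕ) (r : ℝ), 0 < r → r ≤ r₁ →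
      ∀ F : (WilsonWeakCoupling.FreeIdx d n → G) → ℝ≥0∞, Measurable F →
      ((ENNReal.ofReal (κ r ^ D))⁻¹ * ENNReal.ofReal cH) ^
            Fintype.card (WilsonWeakCoupling.FreeIdx d n) *
          ∫⁻ a in Set.pi Set.univ (fun _ => Metric.closedBall (0 : EuclideanSpace ℝ (Fin D)) r),
            F (fun i => ψ (a i)) ≤
        ∫⁻ U in Set.pi Set.univ (fun _ => ψ '' Metric.closedBall 0 r), F U
          ∂(Measure.pi fun _ : WilsonWeakCoupling.FreeIdx d n => haarProbability G)) :
    (∀ (n : ℕ) (β : ℝ), 1 ≤ n → 2 ≤ β → WilsonWeakCoupling.rho0 C d n β ≤ r₁ / 2 →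
      zdPartitionFunction ρ β (halfOpenBox d n) ≤
        2 * (ENNReal.ofReal cH ^ Fintype.card (WilsonWeakCoupling.FreeIdx d n) *
          (ENNReal.ofReal (Real.exp (A₀ * N * β * (2 * WilsonWeakCoupling.rho0 C d n β) ^ 3 *
              (ChatterjeeAssembly.Pn d n : ℝ))) *
            ∫⁻ a : WilsonWeakCoupling.FreeIdx d n → EuclideanSpace ℝ (Fin D),
              ENNReal.ofReal (Real.exp (-β * maxwellV d n a / 2))))) ∧
    (∀ (n : ℕ) (β : ℝ), 1 ≤ n → 0 ≤ β → ∀ r : ℝ, 0 < r → r ≤ r₁ →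
      ((ENNReal.ofReal (κ r ^ D))⁻¹ * ENNReal.ofReal cH) ^
            Fintype.card (WilsonWeakCoupling.FreeIdx d n) *
          (ENNReal.ofReal (Real.exp (-(A₀ * N * β * r ^ 3 * (ChatterjeeAssembly.Pn d n : ℝ)))) *
            ∫⁻ a in Set.pi Set.univ
                (fun _ : WilsonWeakCoupling.FreeIdx d n => Metric.closedBall (0 : EuclideanSpace ℝ (Fin D)) r),
              ENNReal.ofReal (Real.exp (-β * maxwellV d n a / 2))) ≤
        zdPartitionFunction ρ β (halfOpenBox d n)) := by
  sorry

/-- **STUB 6 — Gaussian factorisation over the `D` coordinates and the logarithmic one-box bounds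
(Chatterjee §15/§17, Lemmas 17.2 and 17.6 in logarithmic form).** `M_n(H) = Σ_{k<D} M_n(H^k)`
(`maxwellV` on `ℝ^D` is the sum of `D` scalar axial-gauge Maxwell forms), hence
`∫ e^{−βM_n/2} = β^{−D|E_n^1|/2} Z_M(B_n)^D` and the cube bound
`∫_{‖a_e‖≤r} e^{−βM_n/2} ≥ β^{−D|E_n^1|/2} (Z_M(B_n) τ_n(|y_e| ≤ √β r/max(D,1)))^D`; taking logarithms in
the two Gaussian sandwich inequalities gives the `upper`/`lower` fields of `OneBoxBounds`. Port of
`ChatterjeeAssembly.{maxwell_eq_sum_formM, lintegral_exp_maxwell, lintegral_exp_beta_maxwell,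
le_setLIntegral_exp_beta_maxwell, logZ_le, le_logZ}` with `Fin N × Fin N ↦ Fin D`. [cite: arXiv160201222, Lemmas 17.2, 17.6, §15] -/
theorem stub_logBounds [SecondCountableTopology G] (hd : 1 ≤ d) (ρ : G →* Matrix (Fin N) (Fin N) ℂ)
    (hρ : Continuous ρ) {D : ℕ} {A C cH r₁ : ℝ} (hA : 0 ≤ A) (hC : 0 < C) (hcH : 0 < cH) {κ : ℝ → ℝ}
    (hκ : ∀ r : ℝ, 0 ≤ r → r ≤ r₁ → 1 ≤ κ r)
    (hZ1 : ∀ (n : ℕ) (β : ℝ), 0 ≤ β → zdPartitionFunction ρ β (halfOpenBox d n) ≤ 1)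
    (h71 : ∀ (n : ℕ) (β : ℝ), 2 ≤ β →
      ENNReal.ofReal (Real.exp (-(C * n ^ d * Real.log β))) ≤ zdPartitionFunction ρ β (halfOpenBox d n))
    (hupZ : ∀ (n : ℕ) (β : ℝ), 1 ≤ n → 2 ≤ β → WilsonWeakCoupling.rho0 C d n β ≤ r₁ / 2 →
      zdPartitionFunction ρ β (halfOpenBox d n) ≤
        2 * (ENNReal.ofReal cH ^ Fintype.card (WilsonWeakCoupling.FreeIdx d n) *
          (ENNReal.ofReal (Real.exp (A * β * (2 * WilsonWeakCoupling.rho0 C d n β) ^ 3 *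
              (ChatterjeeAssembly.Pn d n : ℝ))) *
            ∫⁻ a : WilsonWeakCoupling.FreeIdx d n → EuclideanSpace ℝ (Fin D),
              ENNReal.ofReal (Real.exp (-β * maxwellV d n a / 2)))))
    (hlowZ : ∀ (n : ℕ) (β : ℝ), 1 ≤ n → 0 ≤ β → ∀ r : ℝ, 0 < r → r ≤ r₁ →
      ((ENNReal.ofReal (κ r ^ D))⁻¹ * ENNReal.ofReal cH) ^
            Fintype.card (WilsonWeakCoupling.FreeIdx d n) *
          (ENNReal.ofReal (Real.exp (-(A * β * r ^ 3 * (ChatterjeeAssembly.Pn d n : ℝ)))) *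
            ∫⁻ a in Set.pi Set.univ
                (fun _ : WilsonWeakCoupling.FreeIdx d n => Metric.closedBall (0 : EuclideanSpace ℝ (Fin D)) r),
              ENNReal.ofReal (Real.exp (-β * maxwellV d n a / 2))) ≤
        zdPartitionFunction ρ β (halfOpenBox d n)) :
    (∀ (n : ℕ) (β : ℝ), 1 ≤ n → 2 ≤ β → WilsonWeakCoupling.rho0 C d n β ≤ r₁ / 2 →
      Real.log (zdPartitionFunction ρ β (halfOpenBox d n)).toReal ≤
        Real.log 2 + (ChatterjeeAssembly.D₁ d n : ℝ) * Real.log cH +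
          A * β * (2 * WilsonWeakCoupling.rho0 C d n β) ^ 3 * (ChatterjeeAssembly.Pn d n : ℝ) -
          ((ChatterjeeAssembly.D₁ d n : ℝ) * (D : ℝ) / 2) * Real.log β +
          (D : ℝ) * ChatterjeeAssembly.logZM d n) ∧
    (∀ (n : ℕ) (β : ℝ), 1 ≤ n → 2 ≤ β → ∀ (r : ℝ), 0 < r → r ≤ r₁ → ∀ (L : ℝ≥0∞), L ≠ 0 →
      L ≤ LatticeMaxwell.τ (LatticeMaxwell.pinI (d := d)) (0 : Site d) n
        {y | ∀ e, |y e| ≤ Real.sqrt β * r / max (D : ℝ) 1} →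
      (ChatterjeeAssembly.D₁ d n : ℝ) * (Real.log cH - (D : ℝ) * Real.log (κ r)) -
          A * β * r ^ 3 * (ChatterjeeAssembly.Pn d n : ℝ) -
          ((ChatterjeeAssembly.D₁ d n : ℝ) * (D : ℝ) / 2) * Real.log β +
          (D : ℝ) * (ChatterjeeAssembly.logZM d n + Real.log L.toReal) ≤
        Real.log (zdPartitionFunction ρ β (halfOpenBox d n)).toReal) := by
  sorry

end Group

/-- **STUB 7 — transfer from the joint cube limit to the torus free energy of the crux
(`d = 4`, coefficient `3D/2`).** If `F(B_n, β) + ½(3 − 4/n + n^{-4}) D log β → K₀` jointly, then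
`f_r(β) + (3/2)·finrank(span{X | ∀t, exp(tX) ∈ range r.ρ})·log β → K₀`: at fixed `β` the free-boundary
cube free energies converge to the torus free energy density
(`ChatterjeeFreeEnergy.tendsto_freeEnergyPerSite_halfOpenBox`, any compact second-countable `G`), the
coefficient tends to `3/2` (`tendsto_coeff`), `tendsto_of_tendsto_prod_atTop` passes to `β → ∞`, and
`finrank(span …) = finrank(repLieAlgebra r) = D` (`finrank_span_eq_finrank_repLieAlgebra`). Template:
`chatterjee_freeEnergyDensity_of`. [cite: arXiv160201222, Thm. 2.1, §17] -/
theorem stub_transfer {G : Type} [Group G] [TopologicalSpace G] [IsTopologicalGroup G]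
    [CompactSpace G] [MeasurableSpace G] [BorelSpace G] (r : LatticeRep G) {D : ℕ}
    (hD : D = Module.finrank ℝ ↥(repLieAlgebra r)) {K₀ : ℝ}
    (h : Tendsto (fun p : ℕ × ℝ => freeEnergyPerSite r.ρ p.2 (halfOpenBox 4 p.1) +
        (1 / 2) * ((4 : ℝ) - 1 - 4 / p.1 + 1 / (p.1 : ℝ) ^ 4) * (D : ℝ) * Real.log p.2)
      (atTop ×ˢ atTop) (𝓝 K₀)) :
    ∃ K : ℝ, Tendsto (fun β : ℝ => freeEnergyDensity 4 r.ρ β +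
        (3 * (Module.finrank ℝ ↥(Submodule.span ℝ {X : Matrix (Fin r.N) (Fin r.N) ℂ |
          ∀ t : ℝ, NormedSpace.exp ((t : ℂ) • X) ∈ Set.range r.ρ}) : ℝ) / 2) * Real.log β)
      atTop (𝓝 K) := by
  sorry

end Summit.QuantumFields.YangMills.Theorems.FreeEnergyLogCoefficient


/-! ## Composition: the stubs close the crux -/

namespace Summit.QuantumFields.YangMills.Theorems.FreeEnergyLogCoefficient

open scoped Matrix Matrix.Norms.Frobenius ENNReal NNReal
open MeasureTheory Measure Filter Topology Set
open Literature.Probability.LatticeModels Literature.MathematicalPhysics.QuantumLattice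
open Literature.MathematicalPhysics.QuantumFieldTheory

section Compose

variable {d N : ℕ} {G : Type*} [Group G] [TopologicalSpace G] [IsTopologicalGroup G]
  [CompactSpace G] [MeasurableSpace G] [BorelSpace G] (ρ : G →* Matrix (Fin N) (Fin N) ℂ)

omit [TopologicalSpace G] [IsTopologicalGroup G] [CompactSpace G] [MeasurableSpace G] [BorelSpace G] in
/-- `Re tr ρ(g) ≤ N` for a unitary-valued representation. [folklore] -/
theorem re_trace_le_of_unitary (hU : ∀ g, ρ g ∈ Matrix.unitaryGroup (Fin N) ℂ) (g : G) :
    ((ρ g).trace).re ≤ N :=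
  ChatterjeeJointLimit.re_trace_le ⟨ρ g, hU g⟩

omit [TopologicalSpace G] [IsTopologicalGroup G] [CompactSpace G] [MeasurableSpace G] [BorelSpace G] in
/-- `|Re tr ρ(g)| ≤ N` for a unitary-valued representation. [folklore] -/
theorem abs_re_trace_le_of_unitary (hU : ∀ g, ρ g ∈ Matrix.unitaryGroup (Fin N) ℂ) (g : G) :
    |((ρ g).trace).re| ≤ N :=
  ChatterjeeJointLimit.abs_re_trace_le_card ⟨ρ g, hU g⟩

variable [SecondCountableTopology G]

/-- The cube partition function is antitone in the cube (weights `≤ 1`), for any continuous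
unitary-valued representation (`ChatterjeeJointLimit.Z_anti` for `U(N)`). [cite: arXiv160201222, Lemma 17.3 (proof)] -/
theorem zdPartitionFunction_anti (hρ : Continuous ρ) (hU : ∀ g, ρ g ∈ Matrix.unitaryGroup (Fin N) ℂ)
    {β : ℝ} (hβ : 0 ≤ β) {n n' : ℕ} (h : n ≤ n') :
    zdPartitionFunction ρ β (halfOpenBox d n') ≤ zdPartitionFunction ρ β (halfOpenBox d n) := by
  rw [ChatterjeeFreeEnergy.zdPartitionFunction_eq_ofReal ρ hρ β,
    ChatterjeeFreeEnergy.zdPartitionFunction_eq_ofReal ρ hρ β]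
  refine ENNReal.ofReal_le_ofReal (integral_mono ?_ ?_ fun U => ?_)
  · exact AreaLaw.integrable_zdHaar_of_continuous (ChatterjeeFreeEnergy.continuous_labelWeight ρ hρ β _)
  · exact AreaLaw.integrable_zdHaar_of_continuous (ChatterjeeFreeEnergy.continuous_labelWeight ρ hρ β _)
  · exact ChatterjeeFreeEnergy.prod_labelWeight_le_of_subset ρ (re_trace_le_of_unitary ρ hU) hβ
      (ChatterjeeJointLimit.plaquettesIn_mono' (ChatterjeeJointLimit.halfOpenBox_mono' h)) U

/-- `Z(B_n, β).toReal > 0`. [folklore] -/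
theorem zdPartitionFunction_toReal_pos (hρ : Continuous ρ) (β : ℝ) (n : ℕ) :
    0 < (zdPartitionFunction ρ β (halfOpenBox d n)).toReal := by
  rw [ChatterjeeFreeEnergy.zdPartitionFunction_toReal_eq ρ hρ β n]
  exact FreeEnergy.zdZ_pos ρ hρ β _

/-- **The one-box interface of a faithful unitary representation in the exponential chart.** From the
chart package (stub 2), the four-product bound (stub 3), the a-priori bounds (stub 4), the Gaussian
sandwich (stub 5) and its logarithmic form (stub 6), together with the generic scale comparisons of
the tree (Lemmas 17.3, 17.5: `ChatterjeeFreeEnergy.log_Z_mul_le`, `le_log_Z_mul`), the free-boundary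
cube partition functions of `ρ` satisfy `OneBoxBounds d` with `D = dimE ρ`. [cite: arXiv160201222, §17] -/
theorem exists_oneBoxBounds (hd : 1 ≤ d) (hρ : Continuous ρ) (hinj : Function.Injective ρ)
    (hU : ∀ g, ρ g ∈ Matrix.unitaryGroup (Fin N) ℂ) :
    ∃ B : OneBoxBounds d,
      B.logZ = (fun n β => Real.log (zdPartitionFunction ρ β (halfOpenBox d n)).toReal) ∧
      B.D = dimE ρ := by
  obtain ⟨hcont, hψ, hskew, -, cH, r₁, C₁, hcH, hr₁, hr₁2, hC₁, hκ, hball, hincl, hup, hlow⟩ :=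
    stub_expChartPackage ρ hρ hinj hU
  obtain ⟨A₀, hA₀, h4⟩ := stub_fourProduct
  obtain ⟨hZ1, C, hC, h71, h101⟩ := stub_weakCoupling (d := d) ρ hρ hU hC₁ hball
  have hchart := stub_chartAction (d := d) hd ρ hρ hU (lieIso ρ) hskew (expChart ρ) hcont.measurable hψ
    hA₀ (fun Y₁ Y₂ Y₃ Y₄ => h4 Y₁ Y₂ Y₃ Y₄) hC h101 hcH (hr₁2.trans (by norm_num)) (κ := κE)
    (fun r hr0 hr => ⟨(hκ r hr0 hr).1, (hκ r hr0 hr).2.1⟩) hincl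
    (fun n r hr hr' F hF => hup (WilsonWeakCoupling.FreeIdx d n) r hr hr' F hF)
    (fun n r hr hr' F hF => hlow (WilsonWeakCoupling.FreeIdx d n) r hr hr' F hF)
  have hA : 0 ≤ A₀ * N := by positivity
  obtain ⟨hupper, hlower⟩ := stub_logBounds (d := d) hd ρ hρ (D := dimE ρ) hA hC hcH (κ := κE)
    (fun r hr0 hr => (hκ r hr0 hr).1) hZ1 h71 hchart.1 hchart.2
  have hρN := re_trace_le_of_unitary ρ hU
  have hM := abs_re_trace_le_of_unitary ρ hU
  refine ⟨{ logZ := fun n β => Real.log (zdPartitionFunction ρ β (halfOpenBox d n)).toReal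
            D := dimE ρ
            ν := max (dimE ρ : ℝ) 1
            cH := cH
            C71 := C
            A := A₀ * N
            P₅ := (N : ℝ) + N
            r₁ := r₁
            κ := κE
            Kκ := 16
            one_le_ν := le_max_right _ _
            cH_pos := hcH
            C71_pos := hC
            A_nonneg := hA
            P₅_nonneg := by positivity
            r₁_pos := hr₁
            r₁_le := hr₁2
            Kκ_nonneg := by norm_num
            one_le_κ := fun r hr0 hr => (hκ r hr0 hr).1
            log_κ_le := fun r hr0 hr => (hκ r hr0 hr).2.2
            logZ_nonpos := fun n β hβ => ?_
            logZ_anti := fun β hβ n n' hnn' => ?_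
            thm71 := fun n β hβ => ?_
            mul_le := fun β hβ m k => ChatterjeeFreeEnergy.log_Z_mul_le (d := d) ρ hρ hρN hβ m k
            le_mul := fun β hβ n k => ?_
            upper := hupper
            lower := hlower }, rfl, rfl⟩
  · -- `Z ≤ 1`
    have h1 : (zdPartitionFunction ρ β (halfOpenBox d n)).toReal ≤ 1 := by
      simpa using ENNReal.toReal_mono ENNReal.one_ne_top (hZ1 n β hβ)
    exact Real.log_nonpos ENNReal.toReal_nonneg h1
  · -- antitone
    have htop : zdPartitionFunction ρ β (halfOpenBox d n) ≠ ∞ :=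
      ne_top_of_le_ne_top ENNReal.one_ne_top (hZ1 n β hβ)
    exact Real.log_le_log (zdPartitionFunction_toReal_pos ρ hρ β n')
      (ENNReal.toReal_mono htop (zdPartitionFunction_anti ρ hρ hU hβ hnn'))
  · -- Theorem 7.1 in logarithmic form
    have hβ0 : (0 : ℝ) ≤ β := by linarith
    have htop : zdPartitionFunction ρ β (halfOpenBox d n) ≠ ∞ :=
      ne_top_of_le_ne_top ENNReal.one_ne_top (hZ1 n β hβ0)
    have h1 : Real.exp (-(C * n ^ d * Real.log β)) ≤ (zdPartitionFunction ρ β (halfOpenBox d n)).toReal := by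
      have := (ENNReal.toReal_le_toReal ENNReal.ofReal_ne_top htop).2 (h71 n β hβ)
      rwa [ENNReal.toReal_ofReal (Real.exp_pos _).le] at this
    rw [← Real.log_exp (-(C * (n : ℝ) ^ d * Real.log β))]
    exact Real.log_le_log (Real.exp_pos _) h1
  · -- Lemma 17.5
    have := ChatterjeeFreeEnergy.le_log_Z_mul (d := d) ρ hρ hM β n k
    rwa [abs_of_nonneg hβ] at this

end Compose

/-- **The crux from the stubs.** For a compact simple `G` (only compactness and the faithful unitary
representation `r` are used) the one-box interface of `r.ρ` in the exponential chart
(`exists_oneBoxBounds`), the abstract joint limit (stub 1) with Theorem 15.2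
(`LatticeMaxwell.tendsto_logZM_div`), and the transfer to the torus (stub 7) give
`f_r(β) + (3D/2) log β → K_r`. [cite: arXiv160201222, Thm. 2.1] -/
theorem FreeEnergyLogCoefficient_of :
    Summit.QuantumFields.YangMills.Theses.EquipartitionCriticality.FreeEnergyLogCoefficient := by
  intro G _ _ _ _ hG
  letI : MeasurableSpace G := borel G
  haveI : BorelSpace G := ⟨rfl⟩
  intro r
  haveI : SecondCountableTopology (Matrix (Fin r.N) (Fin r.N) ℂ) :=
    inferInstanceAs (SecondCountableTopology (Fin r.N → Fin r.N → ℂ))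
  haveI : SecondCountableTopology G :=
    (r.continuous.isClosedEmbedding r.injective).isEmbedding.secondCountableTopology
  obtain ⟨B, hBlog, hBD⟩ :=
    exists_oneBoxBounds (d := 4) r.ρ (by norm_num) r.continuous r.injective r.mem_unitary
  obtain ⟨L, hL⟩ := LatticeMaxwell.tendsto_logZM_div (d := 4) (by norm_num)
  have hjoint := stub_abstractJointLimit (d := 4) (by norm_num) B hL
  have hdim : dimE r.ρ = Module.finrank ℝ ↥(repLieAlgebra r) :=
    (stub_expChartPackage r.ρ r.continuous r.injective r.mem_unitary).2.2.2.1
  have hjoint' : Tendsto (fun p : ℕ × ℝ => freeEnergyPerSite r.ρ p.2 (halfOpenBox 4 p.1) +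
      (1 / 2) * ((4 : ℝ) - 1 - 4 / p.1 + 1 / (p.1 : ℝ) ^ 4) * (dimE r.ρ : ℝ) * Real.log p.2)
      (atTop ×ˢ atTop) (𝓝 ((((4 : ℕ) : ℝ) - 1) * Real.log B.cH + (B.D : ℝ) * L)) := by
    refine hjoint.congr' ?_
    have hev : ∀ᶠ p : ℕ × ℝ in atTop ×ˢ atTop, 1 ≤ p.1 := (eventually_ge_atTop 1).prod_inl _
    filter_upwards [hev] with p hp
    rw [OneBoxBounds.T, OneBoxBounds.F, hBlog, hBD, ChatterjeeJointLimit.coef_eq (by norm_num) hp,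
      ChatterjeeFreeEnergy.freeEnergyPerSite_halfOpenBox_eq]
    push_cast
    ring
  exact stub_transfer r hdim hjoint'

end Summit.QuantumFields.YangMills.Theorems.FreeEnergyLogCoefficient
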